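import Summits.ResolutionOfSingularities.ResolutionOfSingularities.Theorems.FrobeniusLadderFInjectiveMacaulayficationReesChartCongr
import Summits.ResolutionOfSingularities.ResolutionOfSingularities.Theorems.FrobeniusLadderFInjectiveMacaulayficationE8Char5FiModel
import Summits.ResolutionOfSingularities.ResolutionOfSingularities.Theorems.FrobeniusLadderFInjectiveMacaulayficationReesCoverOfPowers
import HarnessLib

/-!
# Cover certificates (E6‴ format) move along isomorphisms of the base ring
# (crux `FInjectiveMacaulayfication`, T-𝒫 programme, input of §4b)

[OURS · L1 W4.5a · res-L1-w45a-stub-3] Support file (`--supports stmt-ResolutionOfSingularities-15315 --as helper`) for the crux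
`FrobeniusLadder.FInjectiveMacaulayfication`; NOT a statement of any manuscript; AI-written, weaker than expert review.

The certified-chart class `P_cert` of the T-𝒫 programme (`L/w45a/ClassGlueSig.lean` v2 sha16 239444958d057f2d §2) carries, on
an affine chart `Γ(X₁, U)`, the CERTIFICATE BLOCK of E6‴ (`BlowupFiModelOfCover.stub_blowupFiModelOfCover`): an ideal `I`, a
family `v : Fin t → I` with (COV) `R[It]₊ ⊆ √(v₁t, …, v_tt)`, (NZ) `v_j ≠ 0`, and (HON) the Cohen–Macaulay + Frobenius-closed
clause at the maximal ideals containing `v_j/1` of every affine blow-up algebra `R[I/v_j]`. The chart-model corollary §4b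
computes this block on an engine ring `R = k[x]/(f)` (or a localisation of it) and must move it along a ring isomorphism
`ε : R ≃+* Γ(X₁, U)`. This file proves that the block moves:

* `exists_sum_of_irrelevant_le_radical` / `irrelevant_le_radical_of_sum` — (COV) is EQUIVALENT to the hom-stable SUM FORM
  «every `b ∈ I` has a power `b ^ N = Σ_j v_j y_j`, `N ≥ 1`, `y_j ∈ I ^ (N-1)`» (read off the degree-`N` coefficient of
  `(bt)^N ∈ (v_j t)` in `R[It] ⊆ R[t]`; conversely `(bt)^N = Σ_j (v_j t)(y_j t^{N-1})` and `R[It]₊ ⊆ (bt : b ∈ I)`,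
  `irrelevant_le_span_reesT`);
* `cover_congr` — (COV) for `(R, I, v)` gives (COV) for `(R', ε(I), ε ∘ v)`;
* `certificates_congr` — (HON) moves: `R[I/v_j] ≃+* R'[ε(I)/ε(v_j)]` over `ε` (`ReesChartCongr.exists_blowupAlgebra_congr`)
  and the clause at corresponding maximal ideals (`E8Char5FiModel.clause_maximal_of_ringEquiv`);
* `cert_congr` — the whole block (COV) ∧ (NZ) ∧ (HON), in the binder shape of `P_cert`, moves along `ε`;
* `zeroLocus_congr`, `map_ne_bot_of_ringEquiv` — the side conditions `V(I) = V(𝔪)` (as «`I ≤ P ↔ 𝔪 ≤ P` for primes `P`»)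
  and `I ≠ 0` move along `ε`.

References: The Stacks Project, Tag 0804 (charts of the blowing up are the affine blow-up algebras); the transport is folklore.
-/

-- single-problem summit: the doubled namespace component is forced
set_option linter.dupNamespace false

noncomputable section

namespace Summit.ResolutionOfSingularities.ResolutionOfSingularities.Theorems.FInjectiveMacaulayfication.CertifiedCoverCongr

open Polynomial AlgebraicGeometry CategoryTheory Literature.AlgebraicGeometry.Resolution
open Summit.ResolutionOfSingularities.ResolutionOfSingularities.Theorems.FInjectiveMacaulayfication

universe u v

/-! ## §1 The cover inequality in sum form -/

/-- `((b t) ^ N : R[t]) = b ^ N · t ^ N`. [folklore] -/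
theorem coe_reesT_pow {R : Type u} [CommRing R] {I : Ideal R} (b : R) (hb : b ∈ I) (N : ℕ) :
    ((reesT (I := I) b hb ^ N : reesAlgebra I) : R[X]) = monomial N (b ^ N) := by
  rw [Subalgebra.coe_pow, coe_reesT, monomial_pow, one_mul]

/-- **(COV) ⇒ SUM FORM.** If `R[It]₊ ⊆ √(v₁t, …, v_tt)` then every `b ∈ I` has a power
`b ^ N = Σ_j v_j · y_j` with `N ≥ 1` and `y_j ∈ I ^ (N - 1)`: `(bt)^N ∈ (v_j t)` for some `N ≥ 1`, and the degree-`N`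
coefficient of `Σ_j c_j · (v_j t)` is `Σ_j (c_j)_{N-1} v_j` with `(c_j)_{N-1} ∈ I^{N-1}`. [folklore] -/
theorem exists_sum_of_irrelevant_le_radical {R : Type u} [CommRing R] {I : Ideal R} {t : ℕ}
    (v : Fin t → R) (hv : ∀ j : Fin t, v j ∈ I)
    (hcov : (HomogeneousIdeal.irrelevant (reesGrading I)).toIdeal ≤
      (Ideal.span (Set.range fun j : Fin t => reesT (I := I) (v j) (hv j))).radical)
    (b : R) (hb : b ∈ I) :
    ∃ N : ℕ, 0 < N ∧ ∃ y : Fin t → R, (∀ j, y j ∈ I ^ (N - 1)) ∧ b ^ N = ∑ j, v j * y j := by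
  classical
  -- `b t` lies in the irrelevant ideal (homogeneous of degree one), hence in the radical
  have hirr : reesT (I := I) b hb ∈ (HomogeneousIdeal.irrelevant (reesGrading I)).toIdeal :=
    HomogeneousIdeal.mem_irrelevant_of_mem _ Nat.one_pos (reesT_mem b hb)
  obtain ⟨N₀, hN₀⟩ := hcov hirr
  -- bump the exponent to be positive
  have hN : reesT (I := I) b hb ^ (N₀ + 1) ∈
      Ideal.span (Set.range fun j : Fin t => reesT (I := I) (v j) (hv j)) := by
    rw [pow_succ]
    exact Ideal.mul_mem_right _ _ hN₀
  obtain ⟨c, hc⟩ := Ideal.mem_span_range_iff_exists_fun.mp hN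
  refine ⟨N₀ + 1, Nat.succ_pos _, fun j => ((c j : reesAlgebra I) : R[X]).coeff N₀, fun j => ?_, ?_⟩
  · rw [Nat.add_sub_cancel]
    exact (mem_reesAlgebra_iff _ _).mp (c j).2 N₀
  · -- compare degree-`N₀ + 1` coefficients of `hc` in `R[t]`
    have h := congrArg (fun z : reesAlgebra I => (z : R[X]).coeff (N₀ + 1)) hc
    rw [coe_reesT_pow, coeff_monomial, if_pos rfl, AddSubmonoidClass.coe_finsetSum, finsetSum_coeff] at h
    rw [← h]
    refine Finset.sum_congr rfl fun j _ => ?_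
    rw [Subalgebra.coe_mul, coe_reesT, coeff_mul_monomial, mul_comm]

/-- **SUM FORM ⇒ (COV).** If every `b ∈ I` has a power `b ^ N = Σ_j v_j · y_j`, `N ≥ 1`, `y_j ∈ I ^ (N-1)`, then
`R[It]₊ ⊆ √(v₁t, …, v_tt)`: `(bt)^N = Σ_j (v_j t)(y_j t^{N-1}) ∈ (v_j t)` and `R[It]₊ ⊆ (bt : b ∈ I)`
(`irrelevant_le_span_reesT`). [folklore] -/
theorem irrelevant_le_radical_of_sum {R : Type u} [CommRing R] {I : Ideal R} {t : ℕ}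
    (v : Fin t → R) (hv : ∀ j : Fin t, v j ∈ I)
    (hsum : ∀ b ∈ I, ∃ N : ℕ, 0 < N ∧ ∃ y : Fin t → R, (∀ j, y j ∈ I ^ (N - 1)) ∧ b ^ N = ∑ j, v j * y j) :
    (HomogeneousIdeal.irrelevant (reesGrading I)).toIdeal ≤
      (Ideal.span (Set.range fun j : Fin t => reesT (I := I) (v j) (hv j))).radical := by
  classical
  refine le_trans (irrelevant_le_span_reesT I) ?_
  rw [Ideal.span_le]
  rintro _ ⟨⟨b, hb⟩, rfl⟩
  obtain ⟨N, hN, y, hy, hbN⟩ := hsum b hb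
  obtain ⟨k, rfl⟩ : ∃ k, N = k + 1 := ⟨N - 1, by omega⟩
  rw [Nat.add_sub_cancel] at hy
  refine ⟨k + 1, ?_⟩
  -- `(bt)^(k+1) = Σ_j (v_j t) · (y_j t^k)`
  have key : reesT (I := I) b hb ^ (k + 1) =
      ∑ j, reesT (I := I) (v j) (hv j) * ⟨monomial k (y j), reesAlgebra.monomial_mem.mpr (hy j)⟩ := by
    apply Subtype.ext
    rw [coe_reesT_pow, hbN, AddSubmonoidClass.coe_finsetSum, map_sum]
    refine Finset.sum_congr rfl fun j _ => ?_
    rw [Subalgebra.coe_mul, coe_reesT, monomial_mul_monomial, Nat.add_comm 1 k]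
  rw [key]
  exact Ideal.sum_mem _ fun j _ => Ideal.mul_mem_right _ _ (Ideal.subset_span ⟨j, rfl⟩)

/-! ## §2 Transport along a ring isomorphism -/

/-- The SUM FORM moves along a ring isomorphism `ε : R ≃+* R'` (to `ε(I)`, `ε ∘ v`). [folklore] -/
theorem sum_congr {R : Type u} {R' : Type v} [CommRing R] [CommRing R'] (ε : R ≃+* R') {I : Ideal R} {t : ℕ}
    (v : Fin t → R)
    (hsum : ∀ b ∈ I, ∃ N : ℕ, 0 < N ∧ ∃ y : Fin t → R, (∀ j, y j ∈ I ^ (N - 1)) ∧ b ^ N = ∑ j, v j * y j) :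
    ∀ b' ∈ Ideal.map ε I, ∃ N : ℕ, 0 < N ∧ ∃ y' : Fin t → R', (∀ j, y' j ∈ (Ideal.map ε I) ^ (N - 1)) ∧
      b' ^ N = ∑ j, ε (v j) * y' j := by
  intro b' hb'
  rw [Ideal.mem_map_iff_of_surjective ε ε.surjective] at hb'
  -- note: `Ideal.map ε I` as `Ideal.map (ε : R →+* R')`
  obtain ⟨b, hb, rfl⟩ := hb'
  obtain ⟨N, hN, y, hy, hbN⟩ := hsum b hb
  refine ⟨N, hN, fun j => ε (y j), fun j => ?_, ?_⟩
  · rw [← Ideal.map_pow]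
    exact Ideal.mem_map_of_mem _ (hy j)
  · rw [← map_pow, hbN, map_sum]
    exact Finset.sum_congr rfl fun j _ => map_mul ε _ _

/-- **(COV) moves along a ring isomorphism.** [folklore] -/
theorem cover_congr {R : Type u} {R' : Type v} [CommRing R] [CommRing R'] (ε : R ≃+* R') {I : Ideal R} {t : ℕ}
    (v : Fin t → R) (hv : ∀ j : Fin t, v j ∈ I) (hv' : ∀ j : Fin t, ε (v j) ∈ Ideal.map ε I)
    (hcov : (HomogeneousIdeal.irrelevant (reesGrading I)).toIdeal ≤
      (Ideal.span (Set.range fun j : Fin t => reesT (I := I) (v j) (hv j))).radical) :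
    (HomogeneousIdeal.irrelevant (reesGrading (Ideal.map ε I))).toIdeal ≤
      (Ideal.span (Set.range fun j : Fin t => reesT (I := Ideal.map ε I) (ε (v j)) (hv' j))).radical :=
  irrelevant_le_radical_of_sum (fun j => ε (v j)) hv'
    (sum_congr ε v fun b hb => exists_sum_of_irrelevant_le_radical v hv hcov b hb)

/-- **(HON) moves along a ring isomorphism**: the Cohen–Macaulay + Frobenius-closed clause at the maximal ideals containing
`v_j/1` of `R[I/v_j]` gives the same for `R'[ε(I)/ε(v_j)]` at the maximal ideals containing `ε(v_j)/1`
(`ReesChartCongr.exists_blowupAlgebra_congr` + `E8Char5FiModel.clause_maximal_of_ringEquiv`). [folklore] -/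
theorem certificates_congr (p : ℕ) {R R' : Type} [CommRing R] [CommRing R'] (ε : R ≃+* R') {I : Ideal R}
    {t : ℕ} (v : Fin t → R)
    (hon : ∀ (j : Fin t) (Q : Ideal (blowupAlgebra I (v j))) [Q.IsMaximal],
      algebraMap R (blowupAlgebra I (v j)) (v j) ∈ Q →
      ∀ d : ℕ, ringKrullDim (Localization.AtPrime Q) = d → ∀ s : Fin d → Localization.AtPrime Q,
        (Ideal.span (Set.range s)).radical.IsMaximal →
          RingTheory.Sequence.IsWeaklyRegular (Localization.AtPrime Q) (List.ofFn s) ∧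
          ∀ y : Localization.AtPrime Q, (∃ e : ℕ, y ^ p ^ e ∈ Ideal.span
            ((fun z : Localization.AtPrime Q => z ^ p ^ e) ''
              (Ideal.span (Set.range s) : Set (Localization.AtPrime Q)))) → y ∈ Ideal.span (Set.range s)) :
    ∀ (j : Fin t) (Q : Ideal (blowupAlgebra (Ideal.map ε I) (ε (v j)))) [Q.IsMaximal],
      algebraMap R' (blowupAlgebra (Ideal.map ε I) (ε (v j))) (ε (v j)) ∈ Q →
      ∀ d : ℕ, ringKrullDim (Localization.AtPrime Q) = d → ∀ s : Fin d → Localization.AtPrime Q,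
        (Ideal.span (Set.range s)).radical.IsMaximal →
          RingTheory.Sequence.IsWeaklyRegular (Localization.AtPrime Q) (List.ofFn s) ∧
          ∀ y : Localization.AtPrime Q, (∃ e : ℕ, y ^ p ^ e ∈ Ideal.span
            ((fun z : Localization.AtPrime Q => z ^ p ^ e) ''
              (Ideal.span (Set.range s) : Set (Localization.AtPrime Q)))) → y ∈ Ideal.span (Set.range s) := by
  intro j Q _ hQ
  obtain ⟨E₀, hE₀⟩ := ReesChartCongr.exists_blowupAlgebra_congr ε I (v j)
  exact E8Char5FiModel.clause_maximal_of_ringEquiv p E₀ _ _ (hE₀ (v j)) (fun Q' _ hQ' => hon j Q' hQ') Q hQ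

/-- **THE CERTIFICATE BLOCK (COV) ∧ (NZ) ∧ (HON) moves along a ring isomorphism** — in the binder shape of the certified-chart
class `P_cert` (`ClassGlueSig` v2 239444958d057f2d §2). [folklore] -/
theorem cert_congr (p : ℕ) {R R' : Type} [CommRing R] [CommRing R'] (ε : R ≃+* R') (I : Ideal R)
    (h : ∃ (t : ℕ) (v : Fin t → R) (hv : ∀ j : Fin t, v j ∈ I),
          (HomogeneousIdeal.irrelevant (reesGrading I)).toIdeal ≤ (Ideal.span (Set.range fun j : Fin t => reesT (I := I) (v j) (hv j))).radical ∧
          (∀ j : Fin t, v j ≠ 0) ∧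
          ∀ (j : Fin t) (Q : Ideal (Literature.AlgebraicGeometry.Resolution.blowupAlgebra I (v j))) [Q.IsMaximal],
            algebraMap R (Literature.AlgebraicGeometry.Resolution.blowupAlgebra I (v j)) (v j) ∈ Q →
            ∀ d : ℕ, ringKrullDim (Localization.AtPrime Q) = d → ∀ s : Fin d → Localization.AtPrime Q, (Ideal.span (Set.range s)).radical.IsMaximal → RingTheory.Sequence.IsWeaklyRegular (Localization.AtPrime Q) (List.ofFn s) ∧ ∀ y : Localization.AtPrime Q, (∃ e : ℕ, y ^ p ^ e ∈ Ideal.span ((fun z : Localization.AtPrime Q => z ^ p ^ e) '' (Ideal.span (Set.range s) : Set (Localization.AtPrime Q)))) → y ∈ Ideal.span (Set.range s)) :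
    ∃ (t : ℕ) (v : Fin t → R') (hv : ∀ j : Fin t, v j ∈ Ideal.map ε I),
          (HomogeneousIdeal.irrelevant (reesGrading (Ideal.map ε I))).toIdeal ≤ (Ideal.span (Set.range fun j : Fin t => reesT (I := Ideal.map ε I) (v j) (hv j))).radical ∧
          (∀ j : Fin t, v j ≠ 0) ∧
          ∀ (j : Fin t) (Q : Ideal (Literature.AlgebraicGeometry.Resolution.blowupAlgebra (Ideal.map ε I) (v j))) [Q.IsMaximal],
            algebraMap R' (Literature.AlgebraicGeometry.Resolution.blowupAlgebra (Ideal.map ε I) (v j)) (v j) ∈ Q →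
            ∀ d : ℕ, ringKrullDim (Localization.AtPrime Q) = d → ∀ s : Fin d → Localization.AtPrime Q, (Ideal.span (Set.range s)).radical.IsMaximal → RingTheory.Sequence.IsWeaklyRegular (Localization.AtPrime Q) (List.ofFn s) ∧ ∀ y : Localization.AtPrime Q, (∃ e : ℕ, y ^ p ^ e ∈ Ideal.span ((fun z : Localization.AtPrime Q => z ^ p ^ e) '' (Ideal.span (Set.range s) : Set (Localization.AtPrime Q)))) → y ∈ Ideal.span (Set.range s) := by
  obtain ⟨t, v, hv, hcov, hv0, hon⟩ := h
  refine ⟨t, fun j => ε (v j), fun j => Ideal.mem_map_of_mem _ (hv j), cover_congr ε v hv _ hcov,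
    fun j h0 => hv0 j (by simpa using h0), certificates_congr p ε v hon⟩

/-! ## §3 Side conditions -/

/-- `ε(I) ≠ 0` for `I ≠ 0`. [folklore] -/
theorem map_ne_bot_of_ringEquiv {R : Type u} {R' : Type v} [CommRing R] [CommRing R'] (ε : R ≃+* R')
    {I : Ideal R} (hI : I ≠ ⊥) : Ideal.map ε I ≠ ⊥ := by
  intro h
  apply hI
  rw [Ideal.map_eq_bot_iff_of_injective ε.injective] at h
  exact h

/-- The zero-locus condition «`I ≤ P ↔ 𝔪 ≤ P` for every prime `P`» moves along a ring isomorphism. [folklore] -/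
theorem zeroLocus_congr {R : Type u} {R' : Type v} [CommRing R] [CommRing R'] (ε : R ≃+* R')
    {I 𝔪 : Ideal R} (h : ∀ (P : Ideal R), P.IsPrime → (I ≤ P ↔ 𝔪 ≤ P)) :
    ∀ (P' : Ideal R'), P'.IsPrime → (Ideal.map ε I ≤ P' ↔ Ideal.map ε 𝔪 ≤ P') := by
  intro P' hP'
  haveI := hP'
  have key := h (P'.comap ε) inferInstance
  rw [Ideal.map_le_iff_le_comap, Ideal.map_le_iff_le_comap]
  exact key

end Summit.ResolutionOfSingularities.ResolutionOfSingularities.Theorems.FInjectiveMacaulayfication.CertifiedCoverCongr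

end
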